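import Literature.AlgebraicGeometry.Resolution.WeightedBlowupNoIncrease
import Literature.AlgebraicGeometry.Resolution.WeightedBlowupMonomialValuation
import Mathlib.RingTheory.MvPolynomial.WeightedHomogeneous
import Mathlib.Algebra.MvPolynomial.Equiv
import Mathlib.Data.Finsupp.Option
import HarnessLib

/-!
# The order after a weighted step, exactly: the `s`-grading of the transform at a point of the exceptional divisor
(`pub-rosobs`, carver-g38; companion of `WeightedBlowupNoIncrease`)

Polynomial model of ONE weighted blow-up step (conventions of `WeightedBlowupShade`): residual `F ∈ K[u_σ]`, integer
weights `w`, level `ℓ`, proper (cobordant) transform `F' = s^{-ℓ} F(s^{w} u')` in `K[s, u']`, `s = none`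
[cite: AbramovichQuekSchober2025, Def. 4.5], and the transform at a point `b` of the exceptional divisor `{s = 0}`
(`b none = 0`): `pointPolynomial w ℓ b F = F'(s, u' + b)`.

THE `s`-GRADING (derived here, elementary).  Write `F = Σ_m F_m` with `F_m := weightedHomogeneousComponent w m F`
(the `w`-weighted homogeneous components; `F_ℓ = in_w F` is the initial form when the centre is admissible in integer
form, `ℓ ≤ Σ wᵢdᵢ` on the support).  Then, coefficientwise in `s` (`sCoeff k G :=` the coefficient of `s^k` of
`G ∈ K[s,u'] = K[u'][s]`, Mathlib's `optionEquivLeft`):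
* `sCoeff_cobordantTransform`:  `[s^k] F' = F_{ℓ+k}(u')` — the transform is `F' = Σ_k s^k · F_{ℓ+k}(u')`;
* `sCoeff_translate`:  translation by a point of the divisor acts coefficientwise, so
  `sCoeff_pointPolynomial`:  `[s^k] F'(s, u'+b) = F_{ℓ+k}(u' + b|_σ)`;
* `monomialOrd_eq_iInf_sCoeff`:  for any weights `w'` on `(s,u')`, `ord_{w'} G = min_k (k·w'(s) + ord_{w'|u'} [s^k]G)`;
hence the ORDER FORMULA `monomialOrd_pointPolynomial_eq_iInf` / `monomialOrd_one_pointPolynomial_eq_iInf`: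
`ord F'(s, u'+b) = min_{k ≥ 0} ( k + ord_{b|σ} F_{ℓ+k} )`,
and the exact first-entry criterion `monomialOrd_one_pointPolynomial_lt_iff`: the order at `b` is `< ν` (the first entry
of the invariant DROPS at `b`) iff `k + ord_{b|σ}(F_{ℓ+k}) < ν` for some `k` — a closed form in the weighted homogeneous
components of `F` and the point, with no blow-up computation.  The term `k = 0` is the face bound
`ord F'(s,u'+b) ≤ ord_{b|σ}(in_w F)` ("`ν ≤ ν^{log}`" of [cite: AbramovichQuekSchober2024, §6 proof of Thm. 1.1 (3)
(restriction to the fibre s = 0, the weighted normal cone)]), valid for every centre admissible in integer form, every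
dimension and every commutative coefficient ring.  NOT a resolution theorem; instrument typing, NOT summit progress.
-/

open MvPolynomial Finset

open scoped BigOperators

namespace Literature.AlgebraicGeometry.Resolution

namespace WeightedBlowup

noncomputable section

variable {σ : Type*} {K : Type*} [CommRing K]

/-! ## The coefficient of `s^k` -/

/-- `[s^k] G ∈ K[u']`: the coefficient of `s^k` of `G ∈ K[s,u'] = K[u'][s]` (`s = none`; Mathlib's `optionEquivLeft`).
[cite: AbramovichQuekSchober2025, Construction 4.2 (B = Spec O[s, x'], graded by the exceptional variable s)] -/
def sCoeff (k : ℕ) (G : MvPolynomial (Option σ) K) : MvPolynomial σ K :=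
  Polynomial.coeff (optionEquivLeft K σ G) k

/-- Coefficients of `[s^k] G`: `coeff_m ([s^k] G) = coeff_{(k,m)} G`. (derived here)
[cite: AbramovichQuekSchober2025, Construction 4.2] -/
theorem coeff_sCoeff (k : ℕ) (G : MvPolynomial (Option σ) K) (m : σ →₀ ℕ) :
    coeff m (sCoeff k G) = coeff (m.optionElim k) G := by
  have h := optionEquivLeft_coeff_some_coeff_none (R := K) (S₁ := σ) (m.optionElim k) G
  rwa [Finsupp.some_optionElim, Finsupp.optionElim_apply_none] at h

/-- `[s^k]` is additive over finite sums. (derived here) [cite: AbramovichQuekSchober2025, Construction 4.2] -/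
theorem sCoeff_sum {ι : Type*} (k : ℕ) (t : Finset ι) (f : ι → MvPolynomial (Option σ) K) :
    sCoeff k (∑ i ∈ t, f i) = ∑ i ∈ t, sCoeff k (f i) := by
  unfold sCoeff
  rw [map_sum, Polynomial.finsetSum_coeff]

/-- `[s^k]` of a monomial. (derived here) [cite: AbramovichQuekSchober2025, Construction 4.2] -/
theorem sCoeff_monomial [DecidableEq σ] (k : ℕ) (E : Option σ →₀ ℕ) (c : K) :
    sCoeff k (monomial E c) = if E none = k then monomial E.some c else 0 := by
  classical
  unfold sCoeff
  rw [optionEquivLeft_monomial, Polynomial.coeff_monomial]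

/-- `[s^k] 0 = 0`. (derived here) [cite: AbramovichQuekSchober2025, Construction 4.2] -/
@[simp] theorem sCoeff_zero (k : ℕ) : sCoeff k (0 : MvPolynomial (Option σ) K) = 0 := by
  simp [sCoeff]

/-- **Translation by a point OF the exceptional divisor acts coefficientwise in `s`**:
`[s^k] G(s, u'+b) = ([s^k] G)(u' + b|_σ)` when `b none = 0`. (derived here)
[cite: AbramovichQuekSchober2025, Construction 4.2 and Def. 4.5] -/
theorem sCoeff_translate (k : ℕ) (b : Option σ → K) (hb0 : b none = 0) (G : MvPolynomial (Option σ) K) :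
    sCoeff k (PointBlowup.translate b G) = PointBlowup.translate (fun i => b (some i)) (sCoeff k G) := by
  have h : ((optionEquivLeft K σ).toAlgHom.comp
        (aeval fun o => (X o + C (b o) : MvPolynomial (Option σ) K))) =
      (Polynomial.mapAlgHom (aeval fun i => (X i + C (b (some i)) : MvPolynomial σ K))).comp
        (optionEquivLeft K σ).toAlgHom := by
    apply MvPolynomial.algHom_ext
    intro o
    cases o with
    | none =>
        simp [hb0, optionEquivLeft_X_none]
    | some i =>
        simp [optionEquivLeft_X_some, optionEquivLeft_C]
  have hG := congrArg (fun φ : MvPolynomial (Option σ) K →ₐ[K] Polynomial (MvPolynomial σ K) =>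
    Polynomial.coeff (φ G) k) h
  simpa [sCoeff, PointBlowup.translate, Polynomial.coeff_map] using hG

/-- Weight bookkeeping: `weight_{w'} (k, m) = k·w'(s) + weight_{w'|σ} m`. (derived here)
[cite: AbramovichTemkinWlodarczyk2024, Rem. 2.4.2 (monomial valuation)] -/
theorem weight_optionElim (w' : Option σ → ℕ) (k : ℕ) (m : σ →₀ ℕ) :
    Finsupp.weight w' (m.optionElim k) = k * w' none + Finsupp.weight (fun i => w' (some i)) m := by
  simp only [Finsupp.weight_apply]
  rw [Finsupp.sum_option_index_smul, Finsupp.optionElim_apply_none, Finsupp.some_optionElim, smul_eq_mul]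

/-- **The weighted order is read off the `s`-grading**: `ord_{w'} G = min_k ( k·w'(s) + ord_{w'|σ} ([s^k] G) )`
(`⊤` terms for vanishing coefficients). (derived here) [cite: AbramovichTemkinWlodarczyk2024, Rem. 2.4.2] -/
theorem monomialOrd_eq_iInf_sCoeff (w' : Option σ → ℕ) (G : MvPolynomial (Option σ) K) :
    monomialOrd w' G = ⨅ k : ℕ, (((k * w' none : ℕ) : ℕ∞) + monomialOrd (fun i => w' (some i)) (sCoeff k G)) := by
  classical
  apply le_antisymm
  · refine le_iInf fun k => ?_
    by_cases h0 : sCoeff k G = 0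
    · rw [h0, monomialOrd_zero, add_top]
      exact le_top
    obtain ⟨m, hm, hmw⟩ := exists_weight_eq_monomialOrd (fun i => w' (some i)) h0
    rw [← hmw, ← Nat.cast_add, ← weight_optionElim]
    apply monomialOrd_le_weight
    rw [mem_support_iff, ← coeff_sCoeff]
    exact mem_support_iff.mp hm
  · by_cases hG : G = 0
    · rw [hG, monomialOrd_zero]
      exact le_top
    obtain ⟨E, hE, hEw⟩ := exists_weight_eq_monomialOrd w' hG
    rw [← hEw]
    refine (iInf_le _ (E none)).trans ?_
    have hm : E.some ∈ (sCoeff (E none) G).support := by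
      rw [mem_support_iff, coeff_sCoeff, Finsupp.optionElim_some]
      exact mem_support_iff.mp hE
    calc (((E none * w' none : ℕ) : ℕ∞) + monomialOrd (fun i => w' (some i)) (sCoeff (E none) G))
        ≤ ((E none * w' none : ℕ) : ℕ∞) + (Finsupp.weight (fun i => w' (some i)) E.some : ℕ∞) :=
          add_le_add le_rfl (monomialOrd_le_weight _ hm)
      _ = (Finsupp.weight w' E : ℕ∞) := by
          rw [← Nat.cast_add, ← weight_optionElim, Finsupp.optionElim_some]

/-- ORDER form (all weights `1`): `ord G = min_k ( k + ord ([s^k] G) )`. (derived here)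
[cite: AbramovichTemkinWlodarczyk2024, Rem. 2.4.2] -/
theorem monomialOrd_one_eq_iInf_sCoeff (G : MvPolynomial (Option σ) K) :
    monomialOrd (fun _ => 1) G = ⨅ k : ℕ, ((k : ℕ∞) + monomialOrd (fun _ => 1) (sCoeff k G)) := by
  simpa using monomialOrd_eq_iInf_sCoeff (fun _ => 1) G

section Transform

variable [Fintype σ] [DecidableEq σ]

omit [Fintype σ] [DecidableEq σ] in
/-- The old-variable part of a cobordant exponent is the old exponent. (derived here)
[cite: AbramovichQuekSchober2025, Def. 4.5] -/
theorem some_cobordantExponent (w : σ → ℕ) (ℓ : ℕ) (d : σ →₀ ℕ) : (cobordantExponent w ℓ d).some = d := by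
  ext i
  rw [Finsupp.some_apply, cobordantExponent_some]

/-- **The transform is `s`-graded by the weighted homogeneous components**: `[s^k] F' = F_{ℓ+k}` with
`F_m := weightedHomogeneousComponent w m F`, for every centre admissible in integer form (`ℓ ≤ Σ wᵢdᵢ` on the support);
i.e. `F' = Σ_k s^k F_{ℓ+k}(u')`, and `[s^0] F' = in_w F` is the initial form on the weighted normal cone `{s = 0}`.
(derived here) [cite: AbramovichQuekSchober2025, Def. 4.5 and Construction 4.2 (the fibre s = 0 is the weighted normal cone)] -/
theorem sCoeff_cobordantTransform (w : σ → ℕ) (ℓ : ℕ) (F : MvPolynomial σ K)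
    (hF : ∀ d ∈ F.support, ℓ ≤ Finsupp.weight w d) (k : ℕ) :
    sCoeff k (cobordantTransform w ℓ F) = weightedHomogeneousComponent w (ℓ + k) F := by
  classical
  rw [cobordantTransform, sCoeff_sum, weightedHomogeneousComponent_apply, Finset.sum_filter]
  apply Finset.sum_congr rfl
  intro d hd
  rw [sCoeff_monomial, some_cobordantExponent]
  have hnone : cobordantExponent w ℓ d none = (∑ i, w i * d i) - ℓ := cobordantExponent_none w ℓ d
  have hwt : Finsupp.weight w d = ∑ i, w i * d i := by
    rw [Finsupp.weight_apply, Finsupp.sum_fintype _ _ (fun i => by simp)]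
    simp_rw [smul_eq_mul, mul_comm]
  have hiff : cobordantExponent w ℓ d none = k ↔ Finsupp.weight w d = ℓ + k := by
    rw [hnone, ← hwt]
    have := hF d hd
    omega
  by_cases h : Finsupp.weight w d = ℓ + k
  · rw [if_pos (hiff.mpr h), if_pos h]
  · rw [if_neg (fun h' => h (hiff.mp h')), if_neg h]

/-- At a point `b` of the divisor: `[s^k] F'(s, u'+b) = F_{ℓ+k}(u' + b|_σ)`. (derived here)
[cite: AbramovichQuekSchober2025, Def. 4.5 and Construction 4.2] -/
theorem sCoeff_pointPolynomial (w : σ → ℕ) (ℓ : ℕ) (b : Option σ → K) (hb0 : b none = 0)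
    (F : MvPolynomial σ K) (hF : ∀ d ∈ F.support, ℓ ≤ Finsupp.weight w d) (k : ℕ) :
    sCoeff k (pointPolynomial w ℓ b F) =
      PointBlowup.translate (fun i => b (some i)) (weightedHomogeneousComponent w (ℓ + k) F) := by
  rw [pointPolynomial, sCoeff_translate k b hb0, sCoeff_cobordantTransform w ℓ F hF]

/-- **ORDER FORMULA at a point of the exceptional divisor** (any weights `w'` on `(s, u')`):
`ord_{w'} F'(s, u'+b) = min_k ( k·w'(s) + ord_{w'|σ} F_{ℓ+k}(u' + b|_σ) )`. (derived here)
[cite: AbramovichQuekSchober2024, §6 proof of Thm. 1.1 (3) (the k = 0 term: restriction to s = 0)],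
[cite: AbramovichQuekSchober2025, Construction 4.2] -/
theorem monomialOrd_pointPolynomial_eq_iInf (w' : Option σ → ℕ) (w : σ → ℕ) (ℓ : ℕ) (b : Option σ → K)
    (hb0 : b none = 0) (F : MvPolynomial σ K) (hF : ∀ d ∈ F.support, ℓ ≤ Finsupp.weight w d) :
    monomialOrd w' (pointPolynomial w ℓ b F) =
      ⨅ k : ℕ, (((k * w' none : ℕ) : ℕ∞) + monomialOrd (fun i => w' (some i))
        (PointBlowup.translate (fun i => b (some i)) (weightedHomogeneousComponent w (ℓ + k) F))) := by
  rw [monomialOrd_eq_iInf_sCoeff]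
  simp_rw [sCoeff_pointPolynomial w ℓ b hb0 F hF]

/-- **ORDER FORMULA, order form**: `ord F'(s, u'+b) = min_{k ≥ 0} ( k + ord_{b|σ} F_{ℓ+k} )` for every point `b` of the
exceptional divisor and every centre admissible in integer form; the `k = 0` term is the order of the initial form
`in_w F = F_ℓ` at `b|_σ` on the weighted normal cone. (derived here)
[cite: AbramovichQuekSchober2024, Thm. 1.1 (3) and §6], [cite: AbramovichQuekSchober2025, Construction 4.2] -/
theorem monomialOrd_one_pointPolynomial_eq_iInf (w : σ → ℕ) (ℓ : ℕ) (b : Option σ → K) (hb0 : b none = 0)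
    (F : MvPolynomial σ K) (hF : ∀ d ∈ F.support, ℓ ≤ Finsupp.weight w d) :
    monomialOrd (fun _ => 1) (pointPolynomial w ℓ b F) =
      ⨅ k : ℕ, ((k : ℕ∞) + monomialOrd (fun _ => 1)
        (PointBlowup.translate (fun i => b (some i)) (weightedHomogeneousComponent w (ℓ + k) F))) := by
  simpa using monomialOrd_pointPolynomial_eq_iInf (fun _ => 1) w ℓ b hb0 F hF

/-- **Exact first-entry criterion**: the order at `b` is `< ν` — the first entry of the invariant DROPS at `b` when
`ν = ord F = a₁` — iff `k + ord_{b|σ}(F_{ℓ+k}) < ν` for some `k ≥ 0`. (derived here)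
[cite: AbramovichQuekSchober2024, Thm. 1.1 (3)], [cite: AbramovichTemkinWlodarczyk2024, Thm. 6.2.1 (p. 1581) (char 0: the
invariant drops)] -/
theorem monomialOrd_one_pointPolynomial_lt_iff (w : σ → ℕ) (ℓ : ℕ) (b : Option σ → K) (hb0 : b none = 0)
    (F : MvPolynomial σ K) (hF : ∀ d ∈ F.support, ℓ ≤ Finsupp.weight w d) (ν : ℕ∞) :
    monomialOrd (fun _ => 1) (pointPolynomial w ℓ b F) < ν ↔
      ∃ k : ℕ, (k : ℕ∞) + monomialOrd (fun _ => 1)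
        (PointBlowup.translate (fun i => b (some i)) (weightedHomogeneousComponent w (ℓ + k) F)) < ν := by
  rw [monomialOrd_one_pointPolynomial_eq_iInf w ℓ b hb0 F hF, iInf_lt_iff]

/-- The `k`-th bound alone: `ord F'(s, u'+b) ≤ k + ord_{b|σ} F_{ℓ+k}` for every `k`; `k = 0` is the face bound
`ord ≤ ord_{b|σ}(in_w F)`. (derived here) [cite: AbramovichQuekSchober2024, §6 (ν ≤ ν^log)] -/
theorem monomialOrd_one_pointPolynomial_le_component (w : σ → ℕ) (ℓ : ℕ) (b : Option σ → K) (hb0 : b none = 0)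
    (F : MvPolynomial σ K) (hF : ∀ d ∈ F.support, ℓ ≤ Finsupp.weight w d) (k : ℕ) :
    monomialOrd (fun _ => 1) (pointPolynomial w ℓ b F) ≤
      (k : ℕ∞) + monomialOrd (fun _ => 1)
        (PointBlowup.translate (fun i => b (some i)) (weightedHomogeneousComponent w (ℓ + k) F)) := by
  rw [monomialOrd_one_pointPolynomial_eq_iInf w ℓ b hb0 F hF]
  exact iInf_le _ k

end Transform

end

end WeightedBlowup

end Literature.AlgebraicGeometry.Resolution
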